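import Summits.BirchSwinnertonDyer.BirchSwinnertonDyer.Theorems.KolyvaginDepthDoorDepthTableRowKitSecondSign
import Summits.BirchSwinnertonDyer.BirchSwinnertonDyer.Theorems.KolyvaginDepthDoorDepthTableCruxClause
import Literature.NumberTheory.EllipticCurves.BSDSelmerPConverseYanZhuKolyvaginSystemProofs
import Literature.NumberTheory.EllipticCurves.HeegnerPointsOfConductorOneGaloisConjProofs
import Literature.NumberTheory.EllipticCurves.LeadingTermProofs
import HarnessLib

/-!
# Route `KolyvaginDepthDoor` — a SECOND-SIGN row DECIDES THE CRUX AT ITS CURVE: the literal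
# `KolyvaginDepthSupply` clause at a rank-one `W` with a rank-two Heegner twist, from the bit
# `c_1(ℓ) ≠ 0`, WITHOUT Kolyvagin's structure theorem (crux stmt-BirchSwinnertonDyer-21765)

Helper file (`--supports stmt-BirchSwinnertonDyer-21765 --as helper`); it closes nothing and BSD is
not proved by it.

g2's `kolyvaginDepthSupply_clause_of_intModel_certificate` (file `…DepthTableCruxClause`) turned a
FIRST-sign depth-table row into the crux's clause AT THAT CURVE, verbatim, modulo Kolyvagin 1991 Thm. 4
(`hF`, the route's XL support item `KolyvaginStructure`, no `_holds`): the witness is the minimal non-zero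
class of the system and `hF`'s dichotomy pins its depth. On the SECOND sign the structure theorem is
not needed at all:

* `kolyvaginDepthSupply_clause_secondSign_of_intModel_certificate` — under the hypotheses of the
  second-sign row kit `depthRowSecondSign_print_of_datum_of_intModel_certificate` ((γ) =
  `GrossLMS1991.prop37_2_frobeniusCongruence`, the bit `c_1(ℓ) ≠ 0` at ONE datum of conductor `ℓ`,
  `1 ≤ rank_ℤ E(ℚ)`, `2 ≤ rank_ℤ` of the twist model) plus the ordinary certificate at `p`
  (`5 ≤ p`, `p ∤ Δ(E₀)`, `p ∤ a_p`, `p ∤ D`) and KOLYVAGIN'S THEOREM A at `(N_E, E, K)`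
  (`Literature…kolyvagin (W.conductorNorm ℤ) W K`: a Heegner point `y_K` of infinite order forces
  `rank_ℤ E(K) = 1`; Kolyvagin 1990 / Gross 1991 Thm. 1.3 — the named fact of the rank-one routes),
  the crux's clause holds VERBATIM for `W` with the row's `p` and `K`, ON ITS SECOND DISJUNCT
  `ν(n) = rank_ℤ E(ℚ) ∧ rank_ℤ E^{(d_K)}(ℚ) = rank_ℤ E(ℚ) + 1`. PROOF: the witness `(n₀, d₀, M₀)` is a
  non-zero class of minimal depth (`heegnerSystem_exists_minimal_kolyvaginClass_ne_zero`), so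
  `ν(n₀) ≤ ν(ℓ) = 1`; `ν(n₀) = 0` is impossible — then `n₀ = 1`, `P(1) = Tr y(1)` descends to a Heegner
  point `P₀ ∈ E(K)` (`heegnerSystem_exists_isHeegnerPoint_map_eq_derivedPoint_one`, Shimura reciprocity
  at conductor `1` being the tree THEOREM `heegnerPointOfConductor_one_galoisConj_holds`), which is
  TORSION because `rank_ℤ E(K) = rank_ℤ E(ℚ) + rank_ℤ E^{(d_K)}(ℚ) ≥ 1 + 2`
  (`mordellWeilRank_baseChange_quadratic_holds`, PROVED) contradicts Kolyvagin's `rank_ℤ E(K) = 1`, and a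
  torsion `P(1)` has `c_M(1) = 0` for every `M` (`heegnerSystem_kolyvaginClass_eq_zero_of_isOfFinAddOrder`,
  PROVED); hence `ν(n₀) = 1 = rank_ℤ E(ℚ)` and `rank_ℤ E^{(d_K)}(ℚ) = 2` by the row.

So for each second-sign row the crux RESTRICTED TO ITS CURVE is decided by ONE computation modulo
(γ) and Kolyvagin's Theorem A — no `KolyvaginStructure`, no McCallum leaf, no F1 (per-curve corollaries
`SecondSign.C<label>.kolyvaginDepthSupply_clause_secondSign` in the sequel file). HONEST FRAMING: the
crux is a `∀ W` statement; class-wide it stays what g0's calibration says (X1 on non-CM curves at a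
surjective prime, p582259); nothing here moves it; BSD is not proved by it.

References: [Kolyvagin1991MathAnn] Thm. 2.3, §2 Thm. 4; [Kolyvagin1990] Thm. A; [GrossLMS1991]
Thm. 1.3, Prop. 3.7 (2), §4 (P_1 = y_K), Prop. 4.7 (1), §5 (5.1); [McCallumLMS1991] Cor. 4.5;
[Darmon2004] Thm. 3.7; [SilvermanAEC2009] Exercise 10.16, Thm. VIII.6.7; [WZhang2014] Notations (xii),
p. 194; [JetchevLauterStein2009] §3.6 (arXiv:0707.0032).
-/

set_option linter.dupNamespace false

noncomputable section

open scoped Classical NumberField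

namespace Summit.BirchSwinnertonDyer.BirchSwinnertonDyer.Theorems.KolyvaginDepthDoor

open Literature.NumberTheory.EllipticCurves Literature.NumberTheory.EllipticCurves.ModularForms
  Literature.NumberTheory.EllipticCurves.McCallum1991 WeierstrassCurve NumberField IsDedekindDomain
open Literature.NumberTheory.DiophantineGeometry (KodairaSymbol)
open Summit.BirchSwinnertonDyer.BirchSwinnertonDyer.Rank1Residual

section Generic

variable {W : WeierstrassCurve ℚ} [W.IsElliptic] [W.IsGloballyMinimal] {E₀ : WeierstrassCurve ℤ}
  (hI : integralModelInt W = E₀)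
include hI

/-- **The crux `KolyvaginDepthSupply` AT A SECOND-SIGN ROW'S CURVE, verbatim, WITHOUT Kolyvagin's
structure theorem.** Inputs: the second-sign row kit's integer-model certificate (non-CM; `p` with
`ρ̄_{E,p^m}` onto for all `m`; Heegner discriminant `D ∉ {−3, −4}` read off `Δ(E₀)`; Kolyvagin prime `ℓ`
with `M(ℓ) ≥ 1`; the Kodaira–Néron table; `1 ≤ rank_ℤ E(ℚ)`; `2 ≤ rank_ℤ` of the twist model
`V = [0, D b₂, 0, 8 D² b₄, 16 D³ b₆]`), the ordinary certificate at `p` (`5 ≤ p`, `p ∤ Δ(E₀)`,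
`#(E₀ mod p)(𝔽_p) = n_p` with `p ∤ p + 1 − n_p`, `p ∤ D`), the named facts (γ) =
`GrossLMS1991.prop37_2_frobeniusCongruence` and `kolyvagin (W.conductorNorm ℤ) W K` (Kolyvagin 1990
Thm. A: a non-torsion Heegner point gives `rank_ℤ E(K) = 1`), a frame `(Dt, β, ι)`, ONE datum `d` of
conductor `ℓ` and its bit `d.kolyvaginClass _ 1 ≠ 0`. OUTPUT: the body of `KolyvaginDepthSupply` at `W`
(cf. `kolyvaginDepthSupply_iff_forall_clause`, `Iff.rfl`), witnessed by the row's `p`, `K` and the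
minimal non-zero class `(n₀, d₀, M₀)` of the system, on the SECOND rank disjunct: `ν(n₀) = 1`
because a non-zero depth-`0` class would be the class of a torsion point (`P(1) = y_K` up to trace is
torsion: `rank_ℤ E(K) = 1 + 2 ≠ 1`, `mordellWeilRank_baseChange_quadratic_holds` against `kolyvagin`),
and `rank_ℤ E(ℚ) = 1`, `rank_ℤ E^{(d_K)}(ℚ) = 2` by the row kit. CONDITIONAL on (γ), Kolyvagin's
Thm. A and the bit; per-curve; BSD is not proved by it. [cite: Kolyvagin1991MathAnn, Thm. 2.3 and §2 Thm. 4]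
[cite: Kolyvagin1990, Thm. A] [cite: GrossLMS1991, Thm. 1.3, Prop. 3.7 (2), §4 (P_1 = y_K), Prop. 4.7 (1)]
[cite: SilvermanAEC2009, Exercise 10.16 and Thm. VIII.6.7] [cite: WZhang2014, Notations (xii) and p. 194] -/
theorem kolyvaginDepthSupply_clause_secondSign_of_intModel_certificate
    (h372 : GrossLMS1991.prop37_2_frobeniusCongruence)
    (hcm : ¬ W.HasCM) (hr : 1 ≤ W.mordellWeilRank)
    (p : ℕ) [hp : Fact p.Prime] (h5 : 5 ≤ p) (hpΔ : ¬ (p : ℤ) ∣ E₀.Δ) {np : ℕ}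
    (hcardp : Nat.card ((E₀.map (Int.castRingHom (ZMod p))).toAffine.Point) = np)
    (hord : ¬ (p : ℤ) ∣ (p : ℤ) + 1 - np)
    (htower : ∀ n : ℕ, W.HasSurjectiveModNGaloisRep (p ^ n : ℕ))
    (K : Type) [Field K] [NumberField K] (hK : IsImaginaryQuadratic K) {D : ℤ}
    (hD : NumberField.discr K = D) (h3 : D ≠ -3) (h4 : D ≠ -4) (hpD : ¬ (p : ℤ) ∣ D)
    {V : WeierstrassCurve ℤ}
    (hV : (⟨0, D * E₀.b₂, 0, 8 * D ^ 2 * E₀.b₄, 16 * D ^ 3 * E₀.b₆⟩ : WeierstrassCurve ℤ) = V)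
    (hr' : 2 ≤ (V.map (Int.castRingHom ℚ)).mordellWeilRank)
    (hH : ∀ q : ℕ, q.Prime → (q : ℤ) ∣ E₀.Δ → (q = 2 → D % 8 = 1) ∧ (q ≠ 2 → jacobiSym D q = 1))
    (ℓ : ℕ) (hℓ : ℓ.Prime) (hℓ2 : ℓ ≠ 2) (hℓΔ : ¬ (ℓ : ℤ) ∣ E₀.Δ) (hℓD : ¬ (ℓ : ℤ) ∣ D)
    (hℓp : ℓ ≠ p) (hjac : jacobiSym D ℓ = -1) (hℓ1 : p ∣ ℓ + 1) {n : ℕ}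
    (hcard : Nat.card ((E₀.map (Int.castRingHom (ZMod ℓ))).toAffine.Point) = n)
    (haℓ : (p : ℤ) ∣ (ℓ : ℤ) + 1 - n)
    {Δ₀ : ℤ} (hΔ : E₀.Δ = Δ₀) {B : ℕ} (hB : Δ₀.natAbs < B ^ p)
    (htab : ∀ q ∈ Finset.range B, q.Prime → q ∣ Δ₀.natAbs →
      ∃ e ∈ Finset.range 64, q ^ e ∣ Δ₀.natAbs ∧ ¬ q ^ (e + 1) ∣ Δ₀.natAbs ∧ ¬ p ∣ e)
    (hadd : ∀ v : HeightOneSpectrum (𝓞 ℚ), W.HasAdditiveReductionAt v → p ≠ 3 ∨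
      (W.kodairaSymbolAt v ≠ KodairaSymbol.IV ∧ W.kodairaSymbolAt v ≠ KodairaSymbol.IVstar))
    [NeZero (W.conductorNorm ℤ)] (hKoly : kolyvagin (W.conductorNorm ℤ) W K)
    (Dt : ModularParametrizationData W (W.conductorNorm ℤ)) (β : ℤ)
    (ι : K →+* ℂ) (d : KolyvaginHeegnerData Dt β ι ℓ) (hne : d.kolyvaginClass hp.out 1 ≠ 0) :
    ∃ (p : ℕ) (hp : Fact p.Prime), 5 ≤ p ∧ W.HasGoodReductionAtPrime p ∧ ¬ (p : ℤ) ∣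
      W.frobeniusTrace p ∧ W.HasSurjectiveModNGaloisRep p ∧ ∃ (K : Type) (_ : Field K) (_ :
      NumberField K), Literature.NumberTheory.EllipticCurves.IsImaginaryQuadratic K ∧
      NumberField.discr K ≠ -3 ∧ NumberField.discr K ≠ -4 ∧ ¬ ((p : ℤ) ∣ NumberField.discr K) ∧ ¬ (p
      ∣ W.conductorNorm ℤ) ∧ ∃ (_ : NeZero (W.conductorNorm ℤ)),
      Literature.NumberTheory.EllipticCurves.SatisfiesHeegnerHypothesis (W.conductorNorm ℤ) K ∧ ∃
      (Dt : Literature.NumberTheory.EllipticCurves.ModularForms.ModularParametrizationData W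
      (W.conductorNorm ℤ)) (β : ℤ) (ι : K →+* ℂ) (n : ℕ) (d :
      Literature.NumberTheory.EllipticCurves.KolyvaginHeegnerData Dt β ι n) (M : ℕ),
      Literature.NumberTheory.EllipticCurves.KolyvaginDescent.KolSupp
      (Literature.NumberTheory.EllipticCurves.Zhang2014.IsKolyvaginPrime (W.conductorNorm ℤ) W K p)
      n ∧ 1 ≤ M ∧ (M : ℕ∞) ≤ Literature.NumberTheory.EllipticCurves.Zhang2014.levelIndex W p n ∧
      d.kolyvaginClass hp.out M ≠ 0 ∧ (∀ (n' : ℕ) (d' :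
      Literature.NumberTheory.EllipticCurves.KolyvaginHeegnerData Dt β ι n') (M' : ℕ),
      Literature.NumberTheory.EllipticCurves.KolyvaginDescent.KolSupp
      (Literature.NumberTheory.EllipticCurves.Zhang2014.IsKolyvaginPrime (W.conductorNorm ℤ) W K p)
      n' → 1 ≤ M' → (M' : ℕ∞) ≤ Literature.NumberTheory.EllipticCurves.Zhang2014.levelIndex W p n' →
      d'.kolyvaginClass hp.out M' ≠ 0 → n.primeFactors.card ≤ n'.primeFactors.card) ∧
      ((n.primeFactors.card + 1 = W.mordellWeilRank ∧ (W.quadraticTwist (NumberField.discr K :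
      ℚ)).mordellWeilRank < W.mordellWeilRank) ∨ (n.primeFactors.card = W.mordellWeilRank ∧
      (W.quadraticTwist (NumberField.discr K : ℚ)).mordellWeilRank = W.mordellWeilRank + 1)) := by
  obtain ⟨hgood, hordW⟩ := goodOrdinary_of_intModel_certificate hI p hpΔ hcardp hord
  have hpN : ¬ p ∣ W.conductorNorm ℤ := not_dvd_conductorNorm_of_not_dvd_Δ hI hp.out hpΔ
  have hHN : SatisfiesHeegnerHypothesis (W.conductorNorm ℤ) K :=
    satisfiesHeegnerHypothesis_conductorNorm_of_intModel hI K hK.1 hD hH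
  have h3' : NumberField.discr K ≠ -3 := by rw [hD]; exact h3
  have h4' : NumberField.discr K ≠ -4 := by rw [hD]; exact h4
  have hpd' : ¬ ((p : ℤ) ∣ NumberField.discr K) := by rw [hD]; exact hpD
  have hp2 : p ≠ 2 := by omega
  have hsurj : W.HasSurjectiveModNGaloisRep p := by simpa only [pow_one] using htower 1
  obtain ⟨hkol, hlev⟩ := isKolyvaginPrime_of_intModel_certificate hI p K hK.1 hD ℓ hℓ hℓ2 hℓΔ hℓD
    hℓp hjac hℓ1 hcard haℓ
  have hΛ : KolyvaginDescent.KolSupp (Zhang2014.IsKolyvaginPrime (W.conductorNorm ℤ) W K p) ℓ :=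
    KolyvaginDescent.kolSupp_prime hℓ hkol
  -- the row: `rank E(ℚ) = 1`, `rank E^{(D)}(ℚ) = 2`
  obtain ⟨-, hrank, -, hrank', -⟩ := depthRowSecondSign_print_of_datum_of_intModel_certificate hI h372
    hcm hr p hp2 htower K hK hD h3 h4 hV hr' hH ℓ hℓ hℓ2 hℓΔ hℓD hℓp hjac hℓ1 hcard haℓ hΔ hB htab hadd
    Dt β ι d hne
  -- the minimal non-zero class of the system
  obtain ⟨n₀, d₀, M₀, hΛ₀, hM₀, hM₀le, hne₀, hmin⟩ :=
    heegnerSystem_exists_minimal_kolyvaginClass_ne_zero hp.out d hΛ le_rfl hlev hne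
  have hνℓ : ℓ.primeFactors.card = 1 := by rw [hℓ.primeFactors, Finset.card_singleton]
  have hle : n₀.primeFactors.card ≤ 1 := by
    have h := hmin ℓ d 1 hΛ le_rfl hlev hne
    rwa [hνℓ] at h
  -- depth `0` is impossible: the bottom class is the class of a torsion point
  have hν0 : n₀.primeFactors.card ≠ 0 := by
    intro h0
    have hn₀1 : n₀ = 1 := by
      rcases Nat.primeFactors_eq_empty.mp (Finset.card_eq_zero.mp h0) with h | h
      · exact absurd hΛ₀.1 (by rw [h]; exact not_squarefree_zero)
      · exact h
    subst hn₀1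
    obtain ⟨P₀, hheeg, hP₀⟩ := heegnerSystem_exists_isHeegnerPoint_map_eq_derivedPoint_one
      (heegnerPointOfConductor_one_galoisConj_holds (W.conductorNorm ℤ) W K) hK hHN d₀
    have htors : IsOfFinAddOrder P₀ := by
      by_contra hnt
      have h1 := (hKoly hK hHN hheeg hnt).1
      have hsum := mordellWeilRank_baseChange_quadratic_holds W K hK.1
      rw [hD, hrank, hrank'] at hsum
      omega
    have hfin : IsOfFinAddOrder d₀.derivedPoint := by
      rw [← hP₀]
      exact (WeierstrassCurve.Affine.Point.map (W' := W)
        (algebraMap K (ringClassField K ι 1)).toRatAlgHom).isOfFinAddOrder htors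
    exact hne₀ (heegnerSystem_kolyvaginClass_eq_zero_of_isOfFinAddOrder d₀ hp.out M₀ hfin)
  have hν : n₀.primeFactors.card = 1 := by omega
  refine ⟨p, hp, h5, hgood, hordW, hsurj, K, inferInstance, inferInstance, hK, h3', h4', hpd', hpN,
    ‹NeZero (W.conductorNorm ℤ)›, hHN, Dt, β, ι, n₀, d₀, M₀, hΛ₀, hM₀, hM₀le, hne₀, hmin, Or.inr ⟨?_, ?_⟩⟩
  · rw [hν, hrank]
  · rw [hD, hrank', hrank]

end Generic

end Summit.BirchSwinnertonDyer.BirchSwinnertonDyer.Theorems.KolyvaginDepthDoor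

end
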